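import Summits.QuantumFields.YangMills.Theorems.FluxSectorLaplacePeriodicCoreRaritySubQuartic
import Summits.QuantumFields.YangMills.Theorems.FluxSectorLaplaceFluxSectorSuppression
import Summits.QuantumFields.YangMills.Theorems.FluxSectorLaplaceSectorDecomposition
import Summits.QuantumFields.YangMills.Theorems.FluxSectorLaplaceSectorWeightMonotone
import HarnessLib

/-!
# `ToronSmallBall.ToronCoreRaritySubQuartic` (item stmt-QuantumFields-23956) — PROVED: route `FluxSectorLaplace` closes its leaf

Crux r2 of route `ToronSmallBall` = the target leaf of route `FluxSectorLaplace` (D-0145 LINE g13-B of ideator seat ym-idea-4): on the Laplace window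
`L ≤ β^a` the slice-`0` zero-flux thermal weight of the collapsed toron CORE `{polDist ≤ β^(−γc)}`, `γc ≤ 2/5`, in the `2L`-slice ring
(`TT.insTrace`) is `≤ β^(−a) · Z_phys(2L)`.  Every hypothesis of the deciding theorem `FluxSectorLaplace.closes` is a kernel-checked theorem:
K1 `FluxSectorSuppression` ⟨24079⟩ (`fluxSectorSuppression_proof`, flux reflection), K2 `PeriodicCoreRaritySubQuartic` ⟨24080⟩
(`periodicCoreRaritySubQuartic_proof`, seam-axis shift into a constant-centre annulus + own-axis translates), S1 `SectorDecomposition` ⟨24081⟩ and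
S2 `SectorWeightMonotone` ⟨24082⟩ (seat g15).

HONEST FRAMING: a fixed-lattice transfer-matrix estimate uniform on a femto window; route `ToronSmallBall`'s other items are untouched here; nothing
about infinite volume, the continuum limit or the Clay Yang–Mills gap — the YM mass gap is NOT proved.  No `sorry`, no new axiom, no new definition.
References: [cite: Luscher1983, §2]; [cite: tHooft1979]; [cite: MontvayMunster1994, (3.145)].
-/

set_option autoImplicit false

namespace Summit.QuantumFields.YangMills.Theorems.ToronSmallBall

/-- ★ **`ToronSmallBall.ToronCoreRaritySubQuartic` holds** (item stmt-QuantumFields-23956, BY NAME), through `FluxSectorLaplace.closes` fed with the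
four proved items of route `FluxSectorLaplace`.  The YM mass gap is NOT proved. [cite: Luscher1983, §2] [cite: tHooft1979] -/
theorem toronCoreRaritySubQuartic_proof : Summit.QuantumFields.YangMills.Theses.ToronSmallBall.ToronCoreRaritySubQuartic :=
  Summit.QuantumFields.YangMills.Theses.FluxSectorLaplace.closes FluxSectorLaplace.fluxSectorSuppression_proof
    FluxSectorLaplace.periodicCoreRaritySubQuartic_proof FluxSectorLaplace.sectorDecomposition_proof FluxSectorLaplace.sectorWeightMonotone_proof

end Summit.QuantumFields.YangMills.Theorems.ToronSmallBall
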